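/-
# [B4] THEOREM (1.9), THE HÖLDER MEMBER, ON A BOX — ALL PAIRS `x ≠ x′`, hypothesis-free for a regular field constant
near `∂Ω`, uniformly in `η`

statement-level skeleton of published theorems with citation tags; proofs where landed; nothing here is a claim about
the Yang–Mills mass gap

[B4] = Balaban, *Regularity and decay of lattice Green's functions*, Commun. Math. Phys. 89 (1983) 571–597.

THEOREM p.573 (1.9): «… |x−x′|^{−α}|U(A(Γ_{x,x′}))(D^η_{A,μ}G_k(Ω,A)f)(x′) − (D^η_{A,μ}G_k(Ω,A)f)(x)| ≤
c₀exp(−δ₀dist({x,x′}, supp f))‖f‖_∞».  `B4Thm19BoxHolderRegular.thm19_holder_box_regular` proved it on a box for the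
CLOSE pairs `32|x′−x|_∞ ≤ nK` (the walk expansion); for the FAR pairs the Hölder weight `(n/|x′−x|_∞)^α ≤ 2` is harmless
and the quotient is bounded by the derivative member at `x` and at `x′` (`B4Thm110BoxDerivRegular.thm110_deriv_box_
regular`) — the transport `U(A(Γ))` is orthogonal.  THIS FILE glues the two into the print's form with
`dist({x,x′}, supp f)`: `thm19_holder_box_regular_all`.

HONEST SCOPE.  Boxes; `A` regular and constant on the `K`-collar; the chain `Γ` is any nearest-neighbour chain from
`x` to `x′` of length `≤ (d+1)|x′−x|_∞` inside the `|x′−x|_∞`-ball about `x`; `0 ≤ D`.  No `def`, no `Prop` fact, no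
`sorry`; axioms standard.
-/
import Literature.MathematicalPhysics.QuantumFieldTheory.Balaban1983to89.B4Thm19BoxHolderRegular

namespace Literature.MathematicalPhysics.QuantumFieldTheory.Balaban1983to89.B4Thm19BoxHolderAll

open Literature.MathematicalPhysics.QuantumFieldTheory.Balaban1983to89.B4Reflection242 (boxDom nbrs)
open Literature.MathematicalPhysics.QuantumFieldTheory.Balaban1983to89.B4GaugeCovariance
open Literature.MathematicalPhysics.QuantumFieldTheory.Balaban1983to89.B4Lower18Regular (e1 lsum baseEmb stairContour
  transport_fieldLink)
open Literature.MathematicalPhysics.QuantumFieldTheory.Balaban1983to89.B4Lower18RegularRegion (compField)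
open Literature.MathematicalPhysics.QuantumFieldTheory.Balaban1983to89.B4Lemma21Region (siteNorm)
open Literature.MathematicalPhysics.QuantumFieldTheory.Balaban1983to89.B4Lemma22ReduceZero (Box greenA derivA)
open Literature.MathematicalPhysics.QuantumFieldTheory.Balaban1983to89.B4ContourShift (supNorm supNorm_nonneg)
open Literature.MathematicalPhysics.QuantumFieldTheory.Balaban1983to89.B4Lemma22HolderBox (IsNNChain)
open Literature.MathematicalPhysics.QuantumFieldTheory.Balaban1983to89.B4BoxCubeGeometry (posR)
open Literature.MathematicalPhysics.QuantumFieldTheory.Balaban1983to89.B4HolderChainTools (one_le_supNorm_of_ne)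
open Literature.MathematicalPhysics.QuantumFieldTheory.Balaban1983to89.B4Thm110BoxDerivWalk (row_abs_sum_U_le)
open Literature.MathematicalPhysics.QuantumFieldTheory.Balaban1983to89.B4Thm110BoxDerivRegular (thm110_deriv_box_regular)
open Literature.MathematicalPhysics.QuantumFieldTheory.Balaban1983to89.B4Thm19BoxHolderRegular (thm19_holder_box_regular)
open scoped Matrix

noncomputable section

variable {ι : Type} [Fintype ι] [DecidableEq ι]

/-! ## 1. Two elementary bounds; 2. THEOREM (1.9) on a box, all pairs -/

omit [Fintype ι] [DecidableEq ι] in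
/-- `x^α ≤ max 1 x` for `x ≥ 0`, `0 ≤ α ≤ 1` (the Hölder weight of a far pair). [cite: Balaban1983RegularityDecay, (1.9) p.573 «α < 1», dictionary] -/
theorem rpow_le_max_one {x α : ℝ} (hx : 0 ≤ x) (hα0 : 0 ≤ α) (hα1 : α ≤ 1) : x ^ α ≤ max 1 x := by
  by_cases h : x ≤ 1
  · exact (Real.rpow_le_one hx h hα0).trans (le_max_left _ _)
  · have h1 : 1 ≤ x := by linarith
    have h2 := Real.rpow_le_rpow_of_exponent_le h1 hα1
    rw [Real.rpow_one] at h2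
    exact h2.trans (le_max_right _ _)

/-- a component of `U(t)v` is at most `N·max|v|`. [cite: Balaban1983RegularityDecay, (1.2) p.572 «U(A) ∈ O(N)», dictionary] -/
theorem abs_U_mulVec_apply_le (F : OrthFlow ι) (t : ℝ) (v : ι → ℝ) {φ : ℝ} (hφ : 0 ≤ φ) (hv : ∀ k, |v k| ≤ φ)
    (i : ι) : |(F.U t *ᵥ v) i| ≤ (Fintype.card ι : ℝ) * φ := by
  rw [Matrix.mulVec, dotProduct]
  calc |∑ k, F.U t i k * v k| ≤ ∑ k, |F.U t i k * v k| := Finset.abs_sum_le_sum_abs _ _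
    _ ≤ ∑ k, |F.U t i k| * φ := Finset.sum_le_sum fun k _ => by
        rw [abs_mul]; exact mul_le_mul_of_nonneg_left (hv k) (abs_nonneg _)
    _ = (∑ k, |F.U t i k|) * φ := (Finset.sum_mul _ _ _).symm
    _ ≤ (Fintype.card ι : ℝ) * φ := mul_le_mul_of_nonneg_right (row_abs_sum_U_le F t i) hφ

/-- **THEOREM (1.9) OF [B4] ON A BOX, HÖLDER MEMBER, ALL PAIRS — FOR A (1.7)-REGULAR FIELD CONSTANT NEAR `∂Ω`, WITH «e
SUFFICIENTLY SMALL» AND THE LARGE-CUBE SIZE CHOSEN, THE CONSTANT UNIFORM IN `η = L^{-k}`**: for `0 ≤ α < 1` there are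
`K` (`16 ≤ K`, `4 ∣ K`) and `c₁ > 0` such that for all `c ≥ 0`, `β > 0`, `S` there is `e₁ > 0` with — for every
`k ≥ 1`, `(a,m²) ∈ [a₋,a₊]×[0,m²₊]`, box `Ω = Π[0, nMb_μ)` (`K ∣ Mb_μ`, `1 ≤ Mb_μ ≤ S`), component field `A` with
`|A_ν(x+e_μ) − A_ν(x)| ≤ c·e^{β−1}η` on `Ω` and `A = A(0)` on the `K`-collar at `∂Ω`, `0 < e ≤ e₁`, direction `μ`, fine
sites `x ≠ x′` with `x+e_μ, x′+e_μ ∈ Ω`, ANY nearest-neighbour chain `Γ` from `x` to `x′` with `|Γ| ≤ (d+1)|x′−x|_∞`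
inside the `|x′−x|_∞`-ball about `x`, set `P` at unit-lattice sup-distance `≥ D ≥ 0` from BOTH `x` and `x′`, source `f`
supported in `P` with `|f| ≤ φ` —
`(n/|x′−x|_∞)^α·|U(A(Γ))(D^η_{A,μ}G_k(Ω,A)f)(x′) − (D^η_{A,μ}G_k(Ω,A)f)(x)|_i ≤ c₁·e^{−D/K}·φ`.
[cite: Balaban1983RegularityDecay, Theorem (1.9) p.573; Theorem (1.10) p.573; pp.575–579, p.581] -/
theorem thm19_holder_box_regular_all (F : OrthFlow ι) {ℓ₁ : ℝ} (hℓ₁ : 0 ≤ ℓ₁)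
    (hLip : ∀ t (v : ι → ℝ), ((F.U t - 1) *ᵥ v) ⬝ᵥ ((F.U t - 1) *ᵥ v) ≤ (ℓ₁ * t) ^ 2 * (v ⬝ᵥ v))
    (d ℓ : ℕ) (hℓ : 1 ≤ ℓ) (amin aplus m2plus : ℝ) (ha : 0 < amin) (α : ℝ) (hα0 : 0 ≤ α) (hα1 : α < 1) :
    ∃ K : ℕ, 16 ≤ K ∧ 4 ∣ K ∧ ∃ c₁ : ℝ, 0 < c₁ ∧ ∀ (creg β : ℝ), 0 ≤ creg → 0 < β → ∀ (S : ℕ),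
      ∃ e₁ : ℝ, 0 < e₁ ∧ ∀ (k : ℕ), 1 ≤ k → ∀ (hn : 1 ≤ (ℓ + 1) ^ k) (a m2 : ℝ),
      amin ≤ a → a ≤ aplus → 0 ≤ m2 → m2 ≤ m2plus →
      ∀ (Mb : Fin (d + 1) → ℕ), (∀ i, 1 ≤ Mb i) → (∀ i, Mb i ≤ S) → (∀ μ, K ∣ Mb μ) →
      ∀ (Ac : (Fin (d + 1) → ℤ) → Fin (d + 1) → ℝ) (e : ℝ), 0 < e → e ≤ e₁ →
        (∀ x ∈ Box d ℓ k Mb, ∀ μ ν : Fin (d + 1),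
          |Ac (x + e1 μ) ν - Ac x ν| ≤ creg * e ^ (β - 1) / ((ℓ + 1) ^ k : ℕ)) →
        (∀ w ∈ Box d ℓ k Mb, (∃ μ, w μ < (((ℓ + 1) ^ k : ℕ) : ℤ) * K ∨
            (((ℓ + 1) ^ k : ℕ) : ℤ) * Mb μ < w μ + (((ℓ + 1) ^ k : ℕ) : ℤ) * K) → ∀ ν, Ac w ν = Ac 0 ν) →
      ∀ (μ : Fin (d + 1)) (x x' : ↥(Box d ℓ k Mb)), x.1 + e1 μ ∈ Box d ℓ k Mb → x'.1 + e1 μ ∈ Box d ℓ k Mb →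
        x'.1 ≠ x.1 →
      ∀ (l : List ↥(Box d ℓ k Mb)), IsNNChain x l → pathEnd x l = x' →
        (l.length : ℝ) ≤ ((d : ℝ) + 1) * supNorm (x'.1 - x.1) →
        (∀ z ∈ l, supNorm (z.1 - x.1) ≤ supNorm (x'.1 - x.1)) →
      ∀ (P : ↥(Box d ℓ k Mb) → Prop) [DecidablePred P] (D : ℝ), 0 ≤ D →
        (∀ x'', P x'' → ∃ ν, D ≤ |posR ℓ k Mb x ν - posR ℓ k Mb x'' ν|) →
        (∀ x'', P x'' → ∃ ν, D ≤ |posR ℓ k Mb x' ν - posR ℓ k Mb x'' ν|) →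
      ∀ (f : ↥(Box d ℓ k Mb) × ι → ℝ), (∀ p, ¬ P p.1 → f p = 0) → ∀ (φ : ℝ), 0 ≤ φ → (∀ p, |f p| ≤ φ) →
      ∀ i : ι,
        ((((ℓ + 1) ^ k : ℕ) : ℝ) / supNorm (x'.1 - x.1)) ^ α *
          |(transport (fieldLink F (e / ((ℓ + 1) ^ k : ℕ)) (fun u v : ↥(Box d ℓ k Mb) => compField Ac u.1 v.1)) x l
              *ᵥ fld (derivA d F (e / ((ℓ + 1) ^ k : ℕ)) ℓ k Mb (fun u v : ↥(Box d ℓ k Mb) => compField Ac u.1 v.1) μ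
                    *ᵥ (greenA d F (e / ((ℓ + 1) ^ k : ℕ)) ℓ k a m2 Mb (baseEmb hn Mb) (stairContour hn Mb)
                        (fun u v : ↥(Box d ℓ k Mb) => compField Ac u.1 v.1) *ᵥ f)) x'
            - fld (derivA d F (e / ((ℓ + 1) ^ k : ℕ)) ℓ k Mb (fun u v : ↥(Box d ℓ k Mb) => compField Ac u.1 v.1) μ
                    *ᵥ (greenA d F (e / ((ℓ + 1) ^ k : ℕ)) ℓ k a m2 Mb (baseEmb hn Mb) (stairContour hn Mb)
                        (fun u v : ↥(Box d ℓ k Mb) => compField Ac u.1 v.1) *ᵥ f)) x) i|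
          ≤ c₁ * Real.exp (-(D / K)) * φ := by
  obtain ⟨K₁, hK₁, h4₁, c₁, hc₁, H₁⟩ := thm19_holder_box_regular F hℓ₁ hLip d ℓ hℓ amin aplus m2plus ha α hα0 hα1
  obtain ⟨K₂, hK₂, -, c₂, hc₂, H₂⟩ := thm110_deriv_box_regular F hℓ₁ hLip d ℓ hℓ amin aplus m2plus ha
  set K : ℕ := K₁ * K₂ with hK
  have hK₁K : K₁ ≤ K := by rw [hK]; nlinarith
  have hK₂K : K₂ ≤ K := by rw [hK]; nlinarith
  have hK16 : 16 ≤ K := hK₁.trans hK₁K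
  have h4 : 4 ∣ K := dvd_mul_of_dvd_left h4₁ K₂
  have hK₁r : (0 : ℝ) < K₁ := by exact_mod_cast lt_of_lt_of_le (by norm_num) hK₁
  have hK₂r : (0 : ℝ) < K₂ := by exact_mod_cast lt_of_lt_of_le (by norm_num) hK₂
  have hKr : (0 : ℝ) < K := by exact_mod_cast lt_of_lt_of_le (by norm_num) hK16
  set c : ℝ := max c₁ (2 * (((Fintype.card ι : ℝ) + 1) * c₂)) with hc
  refine ⟨K, hK16, h4, c, lt_of_lt_of_le hc₁ (le_max_left _ _), fun creg β hcreg hβ S => ?_⟩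
  obtain ⟨e₁, he₁, H₁'⟩ := H₁ creg β hcreg hβ S
  obtain ⟨e₂, he₂, H₂'⟩ := H₂ creg β hcreg hβ S
  refine ⟨min e₁ e₂, lt_min he₁ he₂, ?_⟩
  intro k hk hn a m2 ea1 ea2 em1 em2 Mb hM hS hKM Ac e he hle h17 hcol μ x x' hxμ hx'μ hne l hl hlend hlen hlnear P _
    D hD0 hD hD' f hfP φ hφ hf i
  have hnr : (0 : ℝ) < (((ℓ + 1) ^ k : ℕ) : ℝ) := by exact_mod_cast hn
  have hKM₁ : ∀ ν, K₁ ∣ Mb ν := fun ν => (Dvd.intro K₂ rfl).trans (hKM ν)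
  have hKM₂ : ∀ ν, K₂ ∣ Mb ν := fun ν => (Dvd.intro_left K₁ rfl).trans (hKM ν)
  -- the collar of width `K` contains the collars of widths `K₁`, `K₂`
  have hcolW : ∀ K' : ℕ, K' ≤ K → ∀ w ∈ Box d ℓ k Mb, (∃ μ, w μ < (((ℓ + 1) ^ k : ℕ) : ℤ) * K' ∨
      (((ℓ + 1) ^ k : ℕ) : ℤ) * Mb μ < w μ + (((ℓ + 1) ^ k : ℕ) : ℤ) * K') → ∀ ν, Ac w ν = Ac 0 ν := by
    intro K' hK' w hw hex
    refine hcol w hw ?_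
    obtain ⟨ν, hν | hν⟩ := hex
    · refine ⟨ν, Or.inl (lt_of_lt_of_le hν ?_)⟩
      exact mul_le_mul_of_nonneg_left (by exact_mod_cast hK') (by positivity)
    · refine ⟨ν, Or.inr (lt_of_lt_of_le hν ?_)⟩
      have : (((ℓ + 1) ^ k : ℕ) : ℤ) * K' ≤ (((ℓ + 1) ^ k : ℕ) : ℤ) * K :=
        mul_le_mul_of_nonneg_left (by exact_mod_cast hK') (by positivity)
      linarith
  -- `e^{−D/Kᵢ} ≤ e^{−D/K}`
  have hexpK : ∀ K' : ℕ, (0 : ℝ) < K' → K' ≤ K → Real.exp (-(D / K')) ≤ Real.exp (-(D / K)) := by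
    intro K' hK'0 hK'
    refine Real.exp_le_exp.2 (neg_le_neg (div_le_div_of_nonneg_left hD0 hK'0 (by exact_mod_cast hK')))
  by_cases hclose : 32 * supNorm (x'.1 - x.1) ≤ (((ℓ + 1) ^ k : ℕ) : ℝ) * K₁
  · -- close pairs: the walk expansion
    have hb := H₁' k hk hn a m2 ea1 ea2 em1 em2 Mb hM hS hKM₁ Ac e he (hle.trans (min_le_left _ _)) h17
      (hcolW K₁ hK₁K) μ x x' hxμ hx'μ hne hclose l hl hlend hlen hlnear P D hD f hfP φ hφ hf i
    exact hb.trans (mul_le_mul_of_nonneg_right (mul_le_mul (le_max_left _ _) (hexpK K₁ hK₁r hK₁K)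
      (Real.exp_pos _).le (hc₁.le.trans (le_max_left _ _))) hφ)
  · -- far pairs: Hölder weight `≤ 2`, derivative member at `x` and at `x′`
    set r : ℝ := supNorm (x'.1 - x.1) with hr
    have hr0 : 0 < r := lt_of_lt_of_le zero_lt_one (one_le_supNorm_of_ne hne)
    have hw2 : ((((ℓ + 1) ^ k : ℕ) : ℝ) / r) ^ α ≤ 2 := by
      refine (rpow_le_max_one (div_nonneg hnr.le hr0.le) hα0 hα1.le).trans (max_le (by norm_num) ?_)
      rw [div_le_iff₀ hr0]
      have hK₁16 : (16 : ℝ) ≤ K₁ := by exact_mod_cast hK₁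
      push Not at hclose
      nlinarith
    have hx1 := H₂' k hk hn a m2 ea1 ea2 em1 em2 Mb hM hS hKM₂ Ac e he (hle.trans (min_le_right _ _)) h17
      (hcolW K₂ hK₂K) μ x hxμ P D hD f hfP φ hφ hf
    have hx2 := H₂' k hk hn a m2 ea1 ea2 em1 em2 Mb hM hS hKM₂ Ac e he (hle.trans (min_le_right _ _)) h17
      (hcolW K₂ hK₂K) μ x' hx'μ P D hD' f hfP φ hφ hf
    set Ψ := derivA d F (e / ((ℓ + 1) ^ k : ℕ)) ℓ k Mb (fun u v : ↥(Box d ℓ k Mb) => compField Ac u.1 v.1) μ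
      *ᵥ (greenA d F (e / ((ℓ + 1) ^ k : ℕ)) ℓ k a m2 Mb (baseEmb hn Mb) (stairContour hn Mb)
          (fun u v : ↥(Box d ℓ k Mb) => compField Ac u.1 v.1) *ᵥ f) with hΨ
    have hb0 : 0 ≤ c₂ * Real.exp (-(D / K₂)) * φ := by positivity
    have hU : |(transport (fieldLink F (e / ((ℓ + 1) ^ k : ℕ)) (fun u v : ↥(Box d ℓ k Mb) => compField Ac u.1 v.1))
        x l *ᵥ fld Ψ x') i| ≤ (Fintype.card ι : ℝ) * (c₂ * Real.exp (-(D / K₂)) * φ) := by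
      rw [transport_fieldLink]
      exact abs_U_mulVec_apply_le F _ _ hb0 (fun k' => hx2 k') i
    have hV : |fld Ψ x i| ≤ c₂ * Real.exp (-(D / K₂)) * φ := hx1 i
    have hdiff : |(transport (fieldLink F (e / ((ℓ + 1) ^ k : ℕ))
          (fun u v : ↥(Box d ℓ k Mb) => compField Ac u.1 v.1)) x l *ᵥ fld Ψ x' - fld Ψ x) i|
        ≤ ((Fintype.card ι : ℝ) + 1) * (c₂ * Real.exp (-(D / K₂)) * φ) := by
      rw [Pi.sub_apply]
      refine (abs_sub _ _).trans ?_
      linarith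
    have hw0 : 0 ≤ ((((ℓ + 1) ^ k : ℕ) : ℝ) / r) ^ α := Real.rpow_nonneg (div_nonneg hnr.le hr0.le) α
    calc ((((ℓ + 1) ^ k : ℕ) : ℝ) / r) ^ α
          * |(transport (fieldLink F (e / ((ℓ + 1) ^ k : ℕ)) (fun u v : ↥(Box d ℓ k Mb) => compField Ac u.1 v.1))
              x l *ᵥ fld Ψ x' - fld Ψ x) i|
        ≤ 2 * (((Fintype.card ι : ℝ) + 1) * (c₂ * Real.exp (-(D / K₂)) * φ)) :=
          mul_le_mul hw2 hdiff (abs_nonneg _) zero_le_two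
      _ = 2 * (((Fintype.card ι : ℝ) + 1) * c₂) * Real.exp (-(D / K₂)) * φ := by ring
      _ ≤ c * Real.exp (-(D / K)) * φ :=
          mul_le_mul_of_nonneg_right (mul_le_mul (le_max_right _ _) (hexpK K₂ hK₂r hK₂K) (Real.exp_pos _).le
            (hc₁.le.trans (le_max_left _ _))) hφ

end

end Literature.MathematicalPhysics.QuantumFieldTheory.Balaban1983to89.B4Thm19BoxHolderAll
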